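import Literature.Combinatorics.Designs.SequenceSumSquares

/-!
# 6-Turyn-type sequences of lengths `m, m, m, m, n, n` and Hadamard matrices of order `4(2m + n)`

[Seberry–Yamada, *Hadamard Matrices* (Wiley 2020)] (`SeberryYamada2020`) Definition 5.3: 6-complementary `±1`
sequences `A, B, C, C, D, D` of lengths `m, m, m, m, n, n` with zero NPAF are *6-Turyn-type sequences*; Theorem 5.2
(Kharaghani–Tayfeh-Rezaie): they give a Baumert–Hall array `BH(4(2m+n); 2m+n, …)` and a Hadamard matrix of order
`4(2m + n)` (the case `m = 36`, `n = 35` is the order `428`).  The Turyn-type sequences `TT(m)` of Best–Đoković–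
Kharaghani–Ramp 2013 (`BaseSequences.IsTurynType`) are the case `n = m - 1`; here the length `n` of the weight-2
sequence `D` is free.

PROVED here for general `m, n`, by the route of `BaseSequences.lean` (base sequences `(C, D ; C, -D ; A ; B)` of lengths
`m+n, m+n, m, m`, then T-sequences of length `2m + n`, then the Cooper–Wallis / Goethals–Seidel step of `TSequences`):
`sixTurynType_baseSeq`, `sixTurynType_tseq`, **`sixTurynType_isHadamard`** (order `4(2m+n)`), the sum-of-squares
condition `x² + y² + 2z² + 2w² = 2(2m + n)` (`sixTurynType_sum_sq`, SY 2020 Lemma 1.19 / the equation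
`214 = …` of §5.8 at `m = 36, n = 35`), and `turynType_sixTurynType` (`TT(m)` is the case `n = m - 1`).
Cell pub-namedobj (venture DiscreteObjects), target H: at `668 = 4·167` every pair `(m, n)` with `2m + n = 167`
(`1 ≤ m ≤ 83`) is a member of this family, `TT(56)` being `(56, 55)`.  No `sorry`, no new axioms.
-/

open Finset BigOperators

namespace Literature.Combinatorics.Designs.SixTurynType

open Literature.Combinatorics.Designs.GoethalsSeidel (gsMatrix IsHadamardMatrix)
open Literature.Combinatorics.Designs.TSequences
open Literature.Combinatorics.Designs.BaseSequences
open Literature.Combinatorics.Designs.SequenceSums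

/-- **6-Turyn-type sequences** `(A, B, C, C, D, D)` of lengths `m, m, m, m, n, n`: here `x, y, z` (`= A, B, C`) of
length `m` and `w` (`= D`) of length `n`, all `±1`, with `N_x(s) + N_y(s) + 2N_z(s) + 2N_w(s) = 0` for every shift
`s ≥ 1` (stated for `s < m + n`; automatic beyond). [cite: SeberryYamada2020, Definition 5.3] -/
def IsSixTurynType (m n : ℕ) (x y z w : ℕ → ℤ) : Prop :=
  PMOn m x ∧ PMOn m y ∧ PMOn m z ∧ PMOn n w ∧
    ∀ s < m + n, s ≠ 0 → NPAF m x s + NPAF m y s + 2 * NPAF m z s + 2 * NPAF n w s = 0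

/-- the weighted autocorrelation condition at every shift `s ≠ 0`. [cite: SeberryYamada2020, Definition 5.3] -/
lemma IsSixTurynType.npaf {m n : ℕ} {x y z w : ℕ → ℤ} (h : IsSixTurynType m n x y z w) {s : ℕ} (hs : s ≠ 0) :
    NPAF m x s + NPAF m y s + 2 * NPAF m z s + 2 * NPAF n w s = 0 := by
  by_cases hlt : s < m + n
  · exact h.2.2.2.2 s hlt hs
  · rw [npaf_of_le x (by omega), npaf_of_le y (by omega), npaf_of_le z (by omega), npaf_of_le w (by omega)]
    simp

/-- **Turyn-type sequences `TT(m)` are 6-Turyn-type sequences of lengths `m, m, m, m, m-1, m-1`.**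
[cite: SeberryYamada2020, Definition 5.3] -/
theorem turynType_sixTurynType {m : ℕ} {x y z w : ℕ → ℤ} (h : IsTurynType m x y z w) :
    IsSixTurynType m (m - 1) x y z w := by
  obtain ⟨hx, hy, hz, hw, hN⟩ := h
  refine ⟨hx, hy, hz, hw, fun s _ hs0 => ?_⟩
  by_cases hsm : s < m
  · exact hN s hsm hs0
  · rw [npaf_of_le x (by omega), npaf_of_le y (by omega), npaf_of_le z (by omega), npaf_of_le w (by omega)]
    simp

/-- conversely, 6-Turyn-type sequences with `n = m - 1` are `TT(m)`. [cite: SeberryYamada2020, Definition 5.3] -/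
theorem sixTurynType_turynType {m : ℕ} {x y z w : ℕ → ℤ} (h : IsSixTurynType m (m - 1) x y z w) :
    IsTurynType m x y z w :=
  ⟨h.1, h.2.1, h.2.2.1, h.2.2.2.1, fun _ _ hs0 => h.npaf hs0⟩

/-! ## Base sequences, T-sequences, Hadamard matrices -/

/-- **6-Turyn-type `(m; n)` ⇒ base sequences `BS(m+n, m+n, m, m)`**: `(z, w ; z, -w ; x ; y)`.
[cite: SeberryYamada2020, Theorem 5.2 (proof)] -/
theorem sixTurynType_baseSeq {m n : ℕ} {x y z w : ℕ → ℤ} (h : IsSixTurynType m n x y z w) :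
    IsBaseSeq (m + n) m (cat m z w) (cat m z fun i => -w i) x y := by
  obtain ⟨hx, hy, hz, hw, -⟩ := id h
  refine ⟨?_, ?_, hx, hy, ?_⟩
  · intro i hi
    unfold cat
    split_ifs with h1
    · exact hz i h1
    · exact hw (i - m) (by omega)
  · intro i hi
    unfold cat
    split_ifs with h1
    · exact hz i h1
    · rcases hw (i - m) (by omega) with e | e <;> simp [e]
  · intro s _ hs0
    have key := npaf_cat_pair m n z w s
    have h2 := h.npaf hs0
    linarith

/-- the T-sequences of 6-Turyn-type sequences (through their base sequences). [cite: SeberryYamada2020, Theorem 5.2] -/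
def sixT (m n : ℕ) (x y z w : ℕ → ℤ) : Fin 4 → ℕ → ℤ :=
  bsT (m + n) (cat m z w) (cat m z fun i => -w i) x y

/-- **6-Turyn-type `(m; n)` ⇒ T-sequences of length `(m + n) + m = 2m + n`.** [cite: SeberryYamada2020, Theorem 5.2] -/
theorem sixTurynType_tseq {m n : ℕ} {x y z w : ℕ → ℤ} (h : IsSixTurynType m n x y z w) :
    IsTSeq (m + n + m) (sixT m n x y z w) :=
  baseSeq_tseq (sixTurynType_baseSeq h)

/-- **Theorem 5.2 (Kharaghani–Tayfeh-Rezaie; Seberry–Yamada).** 6-Turyn-type sequences of lengths `m, m, m, m, n, n`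
give a Hadamard matrix of order `4(2m + n)` (Goethals–Seidel array on the Cooper–Wallis rows of the T-sequences;
length `L = 2m + n` as a parameter). [cite: SeberryYamada2020, Theorem 5.2] -/
theorem sixTurynType_isHadamard {m n : ℕ} {x y z w : ℕ → ℤ} (h : IsSixTurynType m n x y z w) (L : ℕ) [NeZero L]
    (hL : L = m + n + m) :
    IsHadamardMatrix (gsMatrix (cwSeq L (sixT m n x y z w) 0) (cwSeq L (sixT m n x y z w) 1)
      (cwSeq L (sixT m n x y z w) 2) (cwSeq L (sixT m n x y z w) 3)) := by
  subst hL
  exact tseq_isHadamard (sixTurynType_tseq h)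

/-- existence form of Theorem 5.2. [cite: SeberryYamada2020, Theorem 5.2] -/
theorem exists_hadamard_of_sixTurynType {m n : ℕ} {x y z w : ℕ → ℤ} (h : IsSixTurynType m n x y z w) (L : ℕ)
    [NeZero L] (hL : L = m + n + m) :
    ∃ H : Matrix (Fin 4 × ZMod L) (Fin 4 × ZMod L) ℤ, IsHadamardMatrix H :=
  ⟨_, sixTurynType_isHadamard h L hL⟩

/-! ## The sum-of-squares condition `x² + y² + 2z² + 2w² = 2(2m + n)` -/

/-- the element sum of a concatenation. [cite: SeberryYamada2020, Notation 1.44] -/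
lemma sum_cat (m n : ℕ) (z w : ℕ → ℤ) :
    ∑ i ∈ range (m + n), cat m z w i = ∑ i ∈ range m, z i + ∑ i ∈ range n, w i := by
  rw [← Finset.sum_range_add_sum_Ico _ (Nat.le_add_right m n), Finset.sum_Ico_eq_sum_range,
    Nat.add_sub_cancel_left]
  congr 1
  · exact sum_congr rfl fun i hi => if_pos (mem_range.mp hi)
  · refine sum_congr rfl fun j _ => ?_
    rw [show cat m z w (m + j) = w (m + j - m) from if_neg (by omega), Nat.add_sub_cancel_left]

/-- **`x² + y² + 2z² + 2w² = 2(2m + n)`** for the element sums of 6-Turyn-type sequences of lengths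
`m, m, m, m, n, n` (the equation `214 = 0² + 6² + 2·8² + 2·5²`-type solved by Kharaghani–Tayfeh-Rezaie at `m = 36`,
`n = 35`). [cite: SeberryYamada2020, Lemma 1.19 (via Theorem 5.2's base sequences)] -/
theorem sixTurynType_sum_sq {m n : ℕ} {x y z w : ℕ → ℤ} (h : IsSixTurynType m n x y z w) :
    (∑ i ∈ range m, x i) ^ 2 + (∑ i ∈ range m, y i) ^ 2 + 2 * (∑ i ∈ range m, z i) ^ 2 +
      2 * (∑ i ∈ range n, w i) ^ 2 = 2 * (2 * m + n) := by
  have e := baseSeq_sum_sq (sixTurynType_baseSeq h)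
  rw [sum_cat, sum_cat] at e
  have hneg : ∑ i ∈ range n, (fun i => -w i) i = -∑ i ∈ range n, w i := by
    simp [Finset.sum_neg_distrib]
  rw [hneg] at e
  push_cast at e ⊢
  nlinarith [e]

end Literature.Combinatorics.Designs.SixTurynType
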